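import Literature.NumberTheory.Kottwitz1992.VirtualAbelianVarieties
import Literature.NumberTheory.NumberFields.PositiveInvolutionCNumber
import HarnessLib

/-!
# [Kottwitz1992, Lemma 10.3 (2) ⇔ (3) p. 405] Positive involutions on `ℚ[π]` carrying `π` to `cπ⁻¹` ⟺ `|φ(π)|² = c`
# for every `φ : ℚ[π] → ℂ` — DISCHARGED: `Kottwitz1992_10_3_positiveInvolution_iff_absValue_holds`

Kernel-lane companion of the statement carpet ★ `Literature/NumberTheory/Kottwitz1992/VirtualAbelianVarieties.lean` (squad TK,
HCML «GO 500»): the named fact ★ `VirtualAbelianVarieties.Kottwitz1992_10_3_positiveInvolution_iff_absValue` — for a virtual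
abelian variety `A` over `k_r` with Frobenius `π = π_A ∈ End⁰(Ā)` a semisimple element (separable minimal polynomial over `ℚ`)
and `c > 0` rational, «(2) There exists a positive involution on `ℚ[π]` that carries `π` into `cπ⁻¹`» ⟺ «(3) For every
`ℚ`-algebra homomorphism from `ℚ[π]` to `ℂ` the image of `π` has absolute value `c^{1/2}`» — is PROVED here.  THEOREMS ONLY
(no definition, no named fact, no `sorry`, no instance, no notation); cell hodgecm-mathlib, seat B-typ02 (g32); net debt −1.

R. E. Kottwitz, *Points on some Shimura varieties over finite fields*, J. Amer. Math. Soc. 5 (1992) 373–444, Lemma 10.3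
p. 405 (held `paper:doi-10-2307-2152772`, p0033 L10–L16) with its proof «The equivalence of (2) and (3) is proved exactly the
same way as Lemma 10.1.», and Lemma 10.1 p. 404 (p0032 L35–L48), whose printed proof reads: «Tensor `ℚ[π]` with `ℝ` and
decompose it as a product of copies of `ℝ` and `ℂ`.  For both `ℝ` and `ℂ` the only positive involution is `x ↦ x̄`.  Therefore
there is exactly one positive involution `ι` on `ℚ[π] ⊗_ℚ ℝ`, namely, the one that induces `x ↦ x̄` on every copy of `ℝ` and
`ℂ`.  The first condition holds if and only if `ι(π) = cπ⁻¹` (since `ι(π) = cπ⁻¹` implies that `ι(ℚ[π]) = ℚ[π]`), which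
holds if and only if `φ(π)‾ = c φ(π)⁻¹` for every embedding of `ℚ[π]` in `ℂ`, or, in other words, if and only if the second
condition holds.»

THE PROOF FOLLOWED, and where we deviate.  The FIELD case of this argument — `ℚ[π] = ℚ(π)` a number field — is already
the tree's theorem ★ `Literature.NumberTheory.NumberFields.PositiveInvolutionCNumber.exists_positiveInvolution_iff` (Lemma
10.1), resting on ★ `NumberFields.apply_eq_conj_of_trace_mul_nonneg` (Shimura's Lemma 2: an endomorphism of a number field
with non-negative trace form is complex conjugation under every embedding — the «only positive involution is `x ↦ x̄`» step,
done there by weak approximation in `ℚ(π) ⊗ ℝ`).  Lemma 10.3 concerns the semisimple commutative algebra `ℚ[π]`, a finite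
PRODUCT of number fields `ℚ(πⱼ)`; instead of re-running the tensor-with-`ℝ` argument we decompose over `ℚ` (Mathlib
`IsArtinianRing.equivPi`: a reduced finite-dimensional commutative `ℚ`-algebra is the product of its residue fields) and
apply the field case FACTORWISE, which is the same proof organised through the tree: (3) ⇒ (2) — on each factor `ℚ(πⱼ)` the
involution `ρⱼ` inducing `x ↦ x̄` under every embedding exists and is positive, and `σ = ∏ ρⱼ` has trace form the sum of
theirs; (2) ⇒ (3) — positivity forces a positive involution `σ` of `∏ ℚ(πⱼ)` to fix each coordinate idempotent (an
idempotent `e` with `e σ(e) = 0` would have `Tr(e σ e) = 0`), so `σ = ∏ σⱼ` with each `σⱼ` trace-non-negative, hence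
complex conjugation under every embedding (Shimura's Lemma 2), and every `φ : ℚ[π] → ℂ` factors through one `ℚ(πⱼ)`.  The
input «`ℚ[π]` is semisimple» is the hypothesis «`π` semisimple» of the lemma: a separable minimal polynomial makes
`ℚ[π] ≅ ℚ[T]/(f)` reduced (§4).
HONEST LABEL: HC_CM is proved only modulo the 7 printed citations (2 remaining: hLiu418, h413) until rung 0 closes; this file adds
no citation debt (0 facts, 0 sorry) and discharges 1 named fact of ★ `VirtualAbelianVarieties`; it is off the HC_CM cone.

## What is proved (namespace `…VirtualAbelianVarieties.Lemma103` for the steps; folklore plumbing is `private`)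
* §1 (private) `trace_pi_apply` — `Tr_{(∏ Sᵢ)/R} = Σᵢ Tr_{Sᵢ/R}` for finite free algebras (block-diagonal multiplication matrix).
* §2 (private) `exists_eq_comp_eval` — a ring homomorphism from a finite product of fields to a field factors through one
  projection.
* §3 (over any decomposition `e : K ≃ₐ[ℚ] ∏ⱼ Fⱼ` into number fields; private `trace_eq_sum_trace_factors`,
  `single_one_mul_single_one_of_ne`) **`mul_conj_apply_eq_of_trace_mul_pos`** ((2) ⇒ (3)), **`exists_positiveInvolution`**
  ((3) ⇒ (2), for `π` generating `K`), **`exists_positiveInvolution_iff`**.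
* §4 (private; `ℚ[π] = Algebra.adjoin ℚ {π}` inside any `ℚ`-algebra) `adjoin_gen_eq_top`, `finite_adjoin`, `isReduced_adjoin`
  (separable minimal polynomial ⇒ reduced).
* **`Kottwitz1992_10_3_positiveInvolution_iff_absValue_holds`** — the named fact (`ℚ[π]` is commutative through Mathlib's
  scoped `IsMulCommutative` instances for `Algebra.adjoin ℚ {π}`).

## References
* [Kottwitz1992] R. E. Kottwitz, Points on some Shimura varieties over finite fields, J. Amer. Math. Soc. 5 (1992) 373–444,
  §10 Lemma 10.1 (p. 404), Lemma 10.3 (p. 405).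
* [Shimura1998] G. Shimura, Abelian Varieties with Complex Multiplication and Modular Functions (1998), §5.1 Lemma 2 p. 36
  (through the tree's `NumberFields/PositiveInvolution.lean`).
-/

open Polynomial
open scoped ComplexConjugate IntermediateField

namespace Literature.NumberTheory.Kottwitz1992.VirtualAbelianVarieties

namespace Lemma103

/-! ## §1 The trace of a finite product of algebras is the sum of the traces -/

section PiTrace

variable {R : Type*} [CommRing R] {ι : Type*} [Fintype ι] [DecidableEq ι]
  (S : ι → Type*) [∀ i, CommRing (S i)] [∀ i, Algebra R (S i)] [∀ i, Module.Free R (S i)]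
  [∀ i, Module.Finite R (S i)]

/-- `Tr_{(∏ Sᵢ)/R}(y) = Σᵢ Tr_{Sᵢ/R}(yᵢ)` (block-diagonal left-multiplication matrix in the product basis). [folklore] -/
private theorem trace_pi_apply (y : Π i, S i) : Algebra.trace R (Π i, S i) y = ∑ i, Algebra.trace R (S i) (y i) := by
  classical
  let b : ∀ i, Module.Basis (Module.Free.ChooseBasisIndex R (S i)) R (S i) := fun i => Module.Free.chooseBasis R (S i)
  rw [Algebra.trace_eq_matrix_trace (Pi.basis b) y, Matrix.trace, Fintype.sum_sigma]
  refine Finset.sum_congr rfl fun i _ => ?_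
  rw [Algebra.trace_eq_matrix_trace (b i) (y i), Matrix.trace]
  refine Finset.sum_congr rfl fun k _ => ?_
  simp only [Matrix.diag, Algebra.leftMulMatrix_eq_repr_mul, Pi.basis_apply, Pi.basis_repr, Pi.mul_apply,
    Pi.single_eq_same]

end PiTrace

/-! ## §2 Ring homomorphisms from a finite product of fields to a field factor through one coordinate -/

section Factor

variable {J : Type*} [Fintype J] [DecidableEq J] {F : J → Type*} [∀ j, Field (F j)]
  {L : Type*} [Field L]

/-- A ring homomorphism `∏ⱼ Fⱼ → L` into a field factors through a (unique) projection: the images of the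
coordinate idempotents are orthogonal idempotents of `L` summing to `1`, so exactly one of them is `1`. [folklore] -/
private theorem exists_eq_comp_eval (φ : (Π j, F j) →+* L) : ∃ (j : J) (ψ : F j →+* L), ∀ y, φ y = ψ (y j) := by
  -- some coordinate idempotent is not killed
  have hsum : ∑ j, φ (Pi.single j 1) = 1 := by
    rw [← map_sum, Finset.univ_sum_single (fun _ : J => (1 : _))]
    exact map_one φ
  obtain ⟨j, hj⟩ : ∃ j, φ (Pi.single j 1) ≠ 0 := by
    by_contra h
    push Not at h
    rw [Finset.sum_eq_zero fun j _ => h j] at hsum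
    exact zero_ne_one hsum
  -- it is then `1`
  have hidem : φ (Pi.single j 1) * φ (Pi.single j 1) = φ (Pi.single j 1) := by
    rw [← map_mul, ← Pi.single_mul, mul_one]
  have hone : φ (Pi.single j (1 : F j)) = 1 := by
    rcases (mul_right_eq_self₀.mp hidem) with h | h
    · exact h
    · exact absurd h hj
  let ψ : F j →+* L :=
    { toFun := fun a => φ (Pi.single j a)
      map_one' := hone
      map_mul' := fun a b => by simp only [Pi.single_mul, map_mul]
      map_zero' := by simp only [Pi.single_zero, map_zero]
      map_add' := fun a b => by simp only [Pi.single_add, map_add] }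
  refine ⟨j, ψ, fun y => ?_⟩
  change φ y = φ (Pi.single j (y j))
  calc φ y = φ y * φ (Pi.single j 1) := by rw [hone, mul_one]
    _ = φ (Pi.single j (y j)) := by rw [← map_mul, ← Pi.single_mul_right, mul_one]

end Factor

/-! ## §3 The core over a decomposition `K ≃ ∏ⱼ Fⱼ` into number fields -/

section Core

variable {K : Type*} [CommRing K] [Algebra ℚ K]
  {J : Type*} [Fintype J] [DecidableEq J] {F : J → Type*} [∀ j, Field (F j)] [∀ j, NumberField (F j)]

/-- The trace of `K` read through the factors: `Tr_{K/ℚ}(x) = Σⱼ Tr_{Fⱼ/ℚ}((e x)ⱼ)`. [folklore] -/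
private theorem trace_eq_sum_trace_factors (e : K ≃ₐ[ℚ] Π j, F j) (x : K) : Algebra.trace ℚ K x = ∑ j, Algebra.trace ℚ (F j) (e x j) := by
  rw [← Algebra.trace_eq_of_algEquiv e x, trace_pi_apply]

omit [Fintype J] [∀ j, NumberField (F j)] in
/-- Orthogonality of the coordinate idempotents of `∏ⱼ Fⱼ`. [folklore] -/
private theorem single_one_mul_single_one_of_ne {i j : J} (hij : i ≠ j) :
    (Pi.single i (1 : F i) : Π j, F j) * Pi.single j 1 = 0 := by
  ext k
  rw [Pi.mul_apply, Pi.zero_apply]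
  by_cases hk : k = j
  · subst hk
    rw [Pi.single_eq_of_ne (Ne.symm hij), zero_mul]
  · rw [Pi.single_eq_of_ne hk, mul_zero]

/-- **(2) ⇒ (3), factorwise** («proved exactly the same way as Lemma 10.1»): if `σ` is an endomorphism of `K ≃ ∏ⱼ Fⱼ`
with positive definite trace form and `σ(π) π = c`, then `|φ(π)|² = c` for every ring homomorphism `φ : K → ℂ`.
Positivity forces the transported endomorphism `τ = e σ e⁻¹` to fix every coordinate idempotent, hence to be a product
of endomorphisms `τⱼ` of the number fields `Fⱼ`, each with non-negative trace form; by Shimura's Lemma 2 (★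
`NumberFields.apply_eq_conj_of_trace_mul_nonneg`) `τⱼ` is complex conjugation under every embedding, and `φ` factors
through one `Fⱼ` (`exists_eq_comp_eval`). [cite: Kottwitz1992, §10 Lemma 10.3 (p. 405), Lemma 10.1 (p. 404)] -/
theorem mul_conj_apply_eq_of_trace_mul_pos (e : K ≃ₐ[ℚ] Π j, F j) (σ : K →+* K)
    (hσ : ∀ x : K, x ≠ 0 → 0 < Algebra.trace ℚ K (x * σ x)) {π : K} {c : ℚ}
    (hπ : σ π * π = algebraMap ℚ K c) (φ : K →+* ℂ) : φ π * conj (φ π) = c := by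
  classical
  -- the transported endomorphism `τ = e σ e⁻¹` of `∏ F j`
  let τ : (Π j, F j) →+* (Π j, F j) :=
    (e : K ≃+* Π j, F j).toRingHom.comp (σ.comp (e.symm : (Π j, F j) ≃+* K).toRingHom)
  have hτ : ∀ y, τ y = e (σ (e.symm y)) := fun y => rfl
  have heσ : ∀ x, e (σ x) = τ (e x) := fun x => by rw [hτ, e.symm_apply_apply]
  have htr := trace_eq_sum_trace_factors e
  -- Step 1: `τ` does not kill the `j`-th coordinate of the `j`-th idempotent (positivity), so `τ (δⱼ) j = 1`
  have h1 : ∀ j, τ (Pi.single j 1) j = 1 := by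
    intro j
    have hidem : τ (Pi.single j 1) j * τ (Pi.single j 1) j = τ (Pi.single j 1) j := by
      rw [← Pi.mul_apply, ← map_mul, ← Pi.single_mul, mul_one]
    have hne : τ (Pi.single j 1) j ≠ 0 := by
      intro h0
      have hx0 : e.symm (Pi.single j (1 : F j)) ≠ 0 := by
        intro h
        have h' := congrArg (fun y => e y j) h
        simp only [AlgEquiv.apply_symm_apply, Pi.single_eq_same, map_zero, Pi.zero_apply] at h'
        exact one_ne_zero h'
      have hprod : e.symm (Pi.single j (1 : F j)) * σ (e.symm (Pi.single j 1)) = 0 := by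
        apply e.injective
        rw [map_mul, map_zero, e.apply_symm_apply, heσ, e.apply_symm_apply, ← Pi.single_mul_left, one_mul, h0,
          Pi.single_zero]
      have hpos := hσ _ hx0
      rw [hprod, map_zero] at hpos
      exact lt_irrefl _ hpos
    rcases mul_right_eq_self₀.mp hidem with h | h
    · exact h
    · exact absurd h hne
  -- Step 2: `τ (δᵢ) j = 0` for `i ≠ j` (orthogonal idempotents)
  have h2 : ∀ i j, i ≠ j → τ (Pi.single i 1) j = 0 := by
    intro i j hij
    have horth : τ (Pi.single i 1) j * τ (Pi.single j 1) j = 0 := by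
      rw [← Pi.mul_apply, ← map_mul, single_one_mul_single_one_of_ne hij, map_zero, Pi.zero_apply]
    rwa [h1 j, mul_one] at horth
  -- Step 3: `τ` preserves the supports
  have h3 : ∀ (j : J) (a : F j) (i : J), i ≠ j → τ (Pi.single j a) i = 0 := by
    intro j a i hij
    rw [← mul_one a, Pi.single_mul, map_mul, Pi.mul_apply, h2 j i (Ne.symm hij), mul_zero]
  -- Step 4: the induced endomorphisms `τⱼ` of the factors
  let τc : ∀ j, F j →+* F j := fun j =>
    { toFun := fun a => τ (Pi.single j a) j
      map_one' := h1 j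
      map_mul' := fun a b => by simp only [Pi.single_mul, map_mul, Pi.mul_apply]
      map_zero' := by simp only [Pi.single_zero, map_zero, Pi.zero_apply]
      map_add' := fun a b => by simp only [Pi.single_add, map_add, Pi.add_apply] }
  have hτc : ∀ j a, τc j a = τ (Pi.single j a) j := fun j a => rfl
  -- Step 5: `τ` is the product of the `τⱼ`
  have h5 : ∀ y j, τ y j = τc j (y j) := by
    intro y j
    conv_lhs => rw [← Finset.univ_sum_single y]
    rw [map_sum, Finset.sum_apply, Finset.sum_eq_single j (fun i _ hij => h3 i (y i) j hij.symm)
      fun h => (h (Finset.mem_univ j)).elim]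
    exact (hτc j (y j)).symm
  -- Step 6: each `τⱼ` has non-negative (indeed positive definite) trace form
  have h6 : ∀ (j : J) (a : F j), 0 ≤ Algebra.trace ℚ (F j) (a * τc j a) := by
    intro j a
    by_cases ha : a = 0
    · rw [ha, zero_mul, map_zero]
    have hx0 : e.symm (Pi.single j a) ≠ 0 := by
      intro h
      have h' := congrArg (fun y => e y j) h
      simp only [AlgEquiv.apply_symm_apply, Pi.single_eq_same, map_zero, Pi.zero_apply] at h'
      exact ha h'
    have hpos := hσ _ hx0
    rw [htr, Finset.sum_eq_single j ?_ fun h => (h (Finset.mem_univ j)).elim] at hpos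
    · rw [map_mul, e.apply_symm_apply, heσ, e.apply_symm_apply, Pi.mul_apply, h5, Pi.single_eq_same] at hpos
      exact hpos.le
    · intro i _ hij
      rw [map_mul, e.apply_symm_apply, Pi.mul_apply, Pi.single_eq_of_ne hij, zero_mul, map_zero]
  -- Step 7: `φ` factors through one factor `F j`
  obtain ⟨j, ψ, hψ⟩ := exists_eq_comp_eval (φ.comp (e.symm : (Π j, F j) ≃+* K).toRingHom)
  have hφ : ∀ x : K, φ x = ψ (e x j) := fun x => by simpa using hψ (e x)
  -- Step 8: `φ ∘ σ = conj ∘ φ` (Shimura's Lemma 2 on the number field `F j`)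
  have h8 : φ (σ π) = conj (φ π) := by
    rw [hφ, hφ, heσ, h5]
    exact NumberFields.apply_eq_conj_of_trace_mul_nonneg (τc j) (h6 j) ψ (e π j)
  -- Step 9: `|φ π|² = φ(π σ π) = c`
  rw [← h8, ← map_mul, mul_comm, hπ, RingHom.map_rat_algebraMap]
  rfl

/-- **(3) ⇒ (2), factorwise**: if `π` generates `K ≃ ∏ⱼ Fⱼ` as a `ℚ`-algebra and `|φ(π)|² = c > 0` for every
`φ : K → ℂ`, then `K` carries a positive involution `σ` with `σ(π) π = c` — on each number field `Fⱼ = ℚ(πⱼ)` the field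
case ★ `PositiveInvolutionCNumber.exists_positiveInvolution_of_mul_conj_embedding_eq` (Kottwitz's Lemma 10.1: the
involution inducing `x ↦ x̄` under every embedding) gives `ρⱼ`, and `σ = e⁻¹ (∏ ρⱼ) e`; its trace form is the sum of the
positive definite trace forms of the factors. [cite: Kottwitz1992, §10 Lemma 10.3 (p. 405), Lemma 10.1 (p. 404)] -/
theorem exists_positiveInvolution (e : K ≃ₐ[ℚ] Π j, F j) {π : K} (hgen : Algebra.adjoin ℚ {π} = ⊤) {c : ℚ}
    (hc : 0 < c) (h : ∀ φ : K →+* ℂ, φ π * conj (φ π) = c) :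
    ∃ σ : K ≃ₐ[ℚ] K, (∀ x, σ (σ x) = x) ∧ (∀ x : K, x ≠ 0 → 0 < Algebra.trace ℚ K (x * σ x)) ∧
      σ π * π = algebraMap ℚ K c := by
  classical
  have htr := trace_eq_sum_trace_factors e
  -- each factor is generated, as a field, by the image `πⱼ` of `π`
  have hgenj : ∀ j, ℚ⟮e π j⟯ = ⊤ := by
    intro j
    let q : K →ₐ[ℚ] F j := (Pi.evalAlgHom ℚ F j).comp (e : K →ₐ[ℚ] Π j, F j)
    have hq : Function.Surjective q := fun a =>
      ⟨e.symm (Pi.single j a), by simp [q]⟩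
    have hadj : Algebra.adjoin ℚ {q π} = ⊤ := by
      rw [← Set.image_singleton, ← AlgHom.map_adjoin q {π}, hgen, Algebra.map_top, AlgHom.range_eq_top]
      exact hq
    exact (IntermediateField.adjoin_simple_eq_top_iff_of_isAlgebraic (Algebra.IsAlgebraic.isAlgebraic _)).mpr hadj
  -- the hypothesis on each factor
  have hj : ∀ (j : J) (ψ : F j →+* ℂ), ψ (e π j) * conj (ψ (e π j)) = c := fun j ψ => by
    simpa using h (ψ.comp ((Pi.evalRingHom F j).comp (e : K ≃+* Π j, F j).toRingHom))
  -- Kottwitz's Lemma 10.1 on each factor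
  choose ρ hρpos hρinv hρπ using fun j =>
    NumberFields.PositiveInvolutionCNumber.exists_positiveInvolution_of_mul_conj_embedding_eq (hgenj j) hc (hj j)
  -- assemble `σ = e⁻¹ ∘ (∏ ρⱼ) ∘ e`
  let ρP : (Π j, F j) →+* (Π j, F j) := RingHom.pi fun j => (ρ j).comp (Pi.evalRingHom F j)
  have hρP : ∀ y j, ρP y j = ρ j (y j) := fun y j => rfl
  let σ₀ : K →+* K := (e.symm : (Π j, F j) ≃+* K).toRingHom.comp (ρP.comp (e : K ≃+* Π j, F j).toRingHom)
  have hσ₀ : ∀ x, σ₀ x = e.symm (ρP (e x)) := fun x => rfl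
  have heσ₀ : ∀ x j, e (σ₀ x) j = ρ j (e x j) := fun x j => by rw [hσ₀, e.apply_symm_apply, hρP]
  have hinv : ∀ x, σ₀ (σ₀ x) = x := fun x => e.injective (funext fun j => by rw [heσ₀, heσ₀, hρinv])
  let σ : K ≃ₐ[ℚ] K :=
    AlgEquiv.ofRingEquiv (f := RingEquiv.ofRingHom σ₀ σ₀ (RingHom.ext hinv) (RingHom.ext hinv))
      fun r => RingHom.map_rat_algebraMap σ₀ r
  have hσ : ∀ x, σ x = σ₀ x := fun x => rfl
  refine ⟨σ, fun x => by rw [hσ, hσ, hinv], fun x hx => ?_, ?_⟩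
  · -- positivity: the trace form is the sum of those of the factors
    rw [htr]
    obtain ⟨j, hj0⟩ : ∃ j, e x j ≠ 0 := by
      by_contra h0
      push Not at h0
      exact hx (e.injective (by rw [map_zero]; exact funext h0))
    have hterm : ∀ i, e (x * σ x) i = e x i * ρ i (e x i) := fun i => by
      rw [map_mul, Pi.mul_apply, hσ, heσ₀]
    refine Finset.sum_pos' (fun i _ => ?_) ⟨j, Finset.mem_univ _, ?_⟩
    · rw [hterm]
      by_cases hi : e x i = 0
      · rw [hi, zero_mul, map_zero]
      · exact (hρpos i _ hi).le
    · rw [hterm]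
      exact hρpos j _ hj0
  · -- `σ(π) π = c`, checked on each factor
    refine e.injective (funext fun j => ?_)
    rw [map_mul, Pi.mul_apply, hσ, heσ₀, hρπ, AlgEquiv.commutes, Pi.algebraMap_apply]
    rfl

/-- **Lemma 10.3 (2) ⇔ (3) over a decomposition `K ≃ ∏ⱼ Fⱼ` into number fields**, `π` generating `K` as a
`ℚ`-algebra, `c > 0`: «(2) There exists a positive involution on `ℚ[π]` that carries `π` into `cπ⁻¹`» ⟺ «(3) For every
`ℚ`-algebra homomorphism from `ℚ[π]` to `ℂ` the image of `π` has absolute value `c^{1/2}`».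
[cite: Kottwitz1992, §10 Lemma 10.3 (p. 405)] -/
theorem exists_positiveInvolution_iff (e : K ≃ₐ[ℚ] Π j, F j) {π : K} (hgen : Algebra.adjoin ℚ {π} = ⊤) {c : ℚ}
    (hc : 0 < c) :
    (∃ σ : K ≃ₐ[ℚ] K, (∀ x, σ (σ x) = x) ∧ (∀ x : K, x ≠ 0 → 0 < Algebra.trace ℚ K (x * σ x)) ∧
        σ π * π = algebraMap ℚ K c) ↔
      ∀ φ : K →ₐ[ℚ] ℂ, ‖φ π‖ ^ 2 = (c : ℝ) := by
  constructor
  · rintro ⟨σ, -, hσ, hπ⟩ φ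
    have h := mul_conj_apply_eq_of_trace_mul_pos e (σ : K →+* K) hσ hπ (φ : K →+* ℂ)
    rw [AlgHom.coe_toRingHom, Complex.mul_conj, Complex.normSq_eq_norm_sq] at h
    exact_mod_cast h
  · intro h
    have h' : ∀ φ : K →+* ℂ, φ π * conj (φ π) = c := fun φ => by
      rw [Complex.mul_conj, Complex.normSq_eq_norm_sq]
      exact_mod_cast h φ.toRatAlgHom
    exact exists_positiveInvolution e hgen hc h'

end Core

/-! ## §4 The algebra `ℚ[π] = Algebra.adjoin ℚ {π}` of an element with separable minimal polynomial -/

section Adjoin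

variable {E : Type*} [Ring E] [Algebra ℚ E] {π : E}

/-- `ℚ[π]` is generated by `π` (as an algebra over `ℚ`, inside itself). [folklore] -/
private theorem adjoin_gen_eq_top (π : E) :
    Algebra.adjoin ℚ {(⟨π, Algebra.self_mem_adjoin_singleton ℚ π⟩ : Algebra.adjoin ℚ {π})} = ⊤ := by
  apply Subalgebra.map_injective (f := (Algebra.adjoin ℚ {π}).val) Subtype.val_injective
  rw [AlgHom.map_adjoin_singleton, Algebra.map_top, Subalgebra.range_val]
  rfl

/-- `ℚ[π]` is finite-dimensional when `π` is integral. [folklore] -/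
private theorem finite_adjoin (hπ : IsIntegral ℚ π) : Module.Finite ℚ (Algebra.adjoin ℚ {π}) :=
  Module.Finite.iff_fg.mpr hπ.fg_adjoin_singleton

/-- `ℚ[π]` is reduced when the minimal polynomial of `π` is separable (`ℚ[π] ≅ ℚ[T]/(f)` with `f` square-free).
[folklore] -/
private theorem isReduced_adjoin (hsep : (minpoly ℚ π).Separable) : IsReduced (Algebra.adjoin ℚ {π}) := by
  refine ⟨fun y ⟨n, hn⟩ => ?_⟩
  rcases Nat.eq_zero_or_pos n with rfl | hn0
  · rw [pow_zero] at hn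
    exact Subsingleton.elim (h := subsingleton_of_zero_eq_one hn.symm) _ _
  obtain ⟨q, hq⟩ : ∃ q : ℚ[X], aeval π q = (y : E) :=
    (AlgHom.mem_range _).mp ((Algebra.adjoin_singleton_eq_range_aeval ℚ π).le y.2)
  have hdvd : minpoly ℚ π ∣ q ^ n := minpoly.dvd ℚ π (by rw [map_pow, hq, ← Subalgebra.coe_pow, hn, Subalgebra.coe_zero])
  have hdvd' : minpoly ℚ π ∣ q := (hsep.squarefree.dvd_pow_iff_dvd hn0.ne').mp hdvd
  apply Subtype.ext
  rw [Subalgebra.coe_zero, ← hq]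
  obtain ⟨r, hr⟩ := hdvd'
  rw [hr, map_mul, minpoly.aeval, zero_mul]

end Adjoin

end Lemma103

open Lemma103 in
open scoped IsMulCommutative in
/-- **KOTTWITZ 1992, LEMMA 10.3 (2) ⇔ (3), PROVED**: ★ `Kottwitz1992_10_3_positiveInvolution_iff_absValue` holds — for a
virtual abelian variety `A` over `k_r` whose Frobenius `π = π_A` has separable minimal polynomial over `ℚ` and `c > 0`:
«(2) There exists a positive involution on `ℚ[π]` that carries `π` into `cπ⁻¹`» ⟺ «(3) For every `ℚ`-algebra homomorphism
from `ℚ[π]` to `ℂ` the image of `π` has absolute value `c^{1/2}`», «proved exactly the same way as Lemma 10.1»: `ℚ[π]`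
(finite-dimensional, reduced, commutative) is a finite product of number fields `ℚ(πⱼ)` (Mathlib `IsArtinianRing.equivPi`),
and the field case is the tree's ★ `PositiveInvolutionCNumber.exists_positiveInvolution_of_mul_conj_embedding_eq` ∕ ★
`NumberFields.apply_eq_conj_of_trace_mul_nonneg` (Kottwitz's Lemma 10.1, Shimura's Lemma 2), applied factorwise
(`Lemma103.exists_positiveInvolution_iff`). [cite: Kottwitz1992, §10 Lemma 10.3 (p. 405)] -/
theorem Kottwitz1992_10_3_positiveInvolution_iff_absValue_holds :
    Kottwitz1992_10_3_positiveInvolution_iff_absValue := by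
  intro k _ _ p _ _ _ _ r _ X c hc hsep
  classical
  -- `π` is integral over `ℚ` (its minimal polynomial is separable, hence non-zero)
  have hint : IsIntegral ℚ X.frob := by
    by_contra h
    exact hsep.ne_zero (minpoly.eq_zero h)
  -- `ℚ[π]` is a finite-dimensional reduced commutative `ℚ`-algebra generated by `π`
  haveI : IsMulCommutative X.frobAlg := Algebra.isMulCommutative_adjoin_singleton ℚ X.frob
  haveI : Module.Finite ℚ X.frobAlg := finite_adjoin hint
  haveI : IsReduced X.frobAlg := isReduced_adjoin hsep
  haveI : IsArtinianRing X.frobAlg := IsArtinianRing.of_finite ℚ X.frobAlg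
  have hgen : Algebra.adjoin ℚ {X.frobGen} = ⊤ := adjoin_gen_eq_top X.frob
  -- the decomposition of `ℚ[π]` into the number fields `ℚ[π] ⧸ 𝔪`
  haveI : Fintype (MaximalSpectrum X.frobAlg) := Fintype.ofFinite _
  letI : ∀ I : MaximalSpectrum X.frobAlg, Field (X.frobAlg ⧸ I.asIdeal) := fun I =>
    @Ideal.Quotient.field _ _ I.asIdeal I.isMaximal
  haveI : ∀ I : MaximalSpectrum X.frobAlg, NumberField (X.frobAlg ⧸ I.asIdeal) := fun I => by
    have hfin : Module.Finite ℚ (X.frobAlg ⧸ I.asIdeal) :=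
      Module.Finite.of_surjective (Ideal.Quotient.mkₐ ℚ I.asIdeal).toLinearMap
        (Ideal.Quotient.mkₐ_surjective ℚ I.asIdeal)
    haveI : CharZero (X.frobAlg ⧸ I.asIdeal) :=
      charZero_of_injective_algebraMap (algebraMap ℚ (X.frobAlg ⧸ I.asIdeal)).injective
    exact @NumberField.mk _ _ inferInstance (by convert hfin; exact Subsingleton.elim _ _)
  exact exists_positiveInvolution_iff (K := X.frobAlg) (F := fun I : MaximalSpectrum X.frobAlg => X.frobAlg ⧸ I.asIdeal)
    (AlgEquiv.ofRingEquiv (f := (IsArtinianRing.equivPi X.frobAlg).toRingEquiv) fun x =>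
      RingHom.map_rat_algebraMap (IsArtinianRing.equivPi X.frobAlg).toRingEquiv.toRingHom x)
    hgen hc

end Literature.NumberTheory.Kottwitz1992.VirtualAbelianVarieties
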